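import Literature.Topology.FourManifolds.LefschetzBaseCircleMapsClopen
import Literature.Topology.FourManifolds.LefschetzBaseSymmetries
import Literature.Geometry.Manifold.CircleMapForm
import Mathlib.Topology.Homotopy.Lifting
import Mathlib.Analysis.Convex.Contractible
import Mathlib.Topology.Algebra.Module.LocallyConvex
import Mathlib.AlgebraicTopology.FundamentalGroupoid.SimplyConnected
import HarnessLib

/-!
# The Mayer–Vietoris circle maps of the Lefschetz base lift near the binding

Topic `Literature/Topology/FourManifolds`.  The circle-valued maps `phi g j : Base g → ℝ/ℤ` of
`LefschetzBaseCircleMaps.lean` (dual to the Milnor chain basis of `H₁(Base g; ℤ)`) are shown to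
admit a **smooth real lift on the whole binding tube** `{‖w‖ < 1/4} ⊂ ∂ Base g` of the boundary
open book (`LefschetzBaseOpenBook.lean`: `tube g : 𝕊¹ × ℝ² → ∂ Base g`, an open smooth embedding
with image `{‖w‖ < 1/4}` whose core is the binding):

* `LefschetzBase.exists_smooth_lift_phi_incl_tube` — `∃ L`, smooth at the points of
  `range (tube g)`, with `phi g j ∘ incl = L mod 1` there.

This is the last base-side input of the Legendrian-realisation step of
`Literature.Geometry.Symplectic.palf_stein_supportedByBoundaryOpenBook`: composed with the
boundary identification and cut off inside the tubes (`OpenBook.circleCutoff`), `d(phi g j ∘ F)`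
becomes the closed form `η` vanishing near the binding that
`OpenBook.IsGirouxForm.exists_girouxForm_legendrian` consumes.

**Proof** (Bott–Tu 1982, §2 with the `μ₂ × μ_{2g+1}`-symmetry of the Milnor fibre, Milnor 1968
§9).  Pull `φ_C = phiOf C` (`C ⊆ U ∩ V` clopen, `LefschetzBaseCircleMapsClopen.lean`) back along
`(t, v) ↦ incl (tube g (circlePt t, v))` to the convex, hence simply connected, `ℝ × ℝ²`, and
lift it through the covering `ℝ → ℝ/ℤ` (Mathlib's lifting criterion).  The period defect
`d(C) = Λ(t + 1, v) − Λ(t, v) ∈ ℤ` is a constant, additive over disjoint unions, zero for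
`C = U ∩ V` (whose map is `ρ_V mod 1`), and invariant under `C ↦ T⁻¹C` for the sheet involution
and the sector rotation (`LefschetzBaseSymmetries.lean`), because these act on the tube parameter
by the translations `t ↦ t + 1/2`, `t ↦ t + 1/2 + 1/(2(2g+1))` (`tubeAmb_neg` and its analogue).
Since they permute the `2(2g+1)` components of `U ∩ V` transitively, all components have the same
defect, which therefore vanishes; so does the defect of `C_j`, a union of components.  A lift with
zero defect is `1`-periodic and descends, through the angle functions `angA`, `angB` of
`TorusCoordinates.lean` and `tubeInv`, to a continuous — hence, `phi` having smooth local lifts,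
smooth — lift on the tube.  Everything is proved; no named facts.

## References
* R. Bott, L. W. Tu, *Differential Forms in Algebraic Topology* (1982), §2 Prop. 2.3. [BottTu1982Forms]
* J. Milnor, *Singular points of complex hypersurfaces* (1968), §9. [Milnor1968]
* A. Hatcher, *Algebraic Topology* (2002), Prop. 1.33 (lifting criterion). [HatcherAT2002]
-/

noncomputable section

open scoped Manifold ContDiff Topology Real
open Set Function Filter Complex
open Literature.Topology.FourManifolds.TorusKnotMilnor
open Literature.AlgebraicTopology.SingularHomology

namespace Literature.Topology.FourManifolds

/-- Local notation: `𝔼 n` is the model Euclidean space `EuclideanSpace ℝ (Fin n)`. -/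
local notation "𝔼 " n:arg => EuclideanSpace ℝ (Fin n)

/-- Local notation: `𝕊 n` is the unit sphere in `EuclideanSpace ℝ (Fin (n + 1))`. -/
local notation "𝕊 " n:arg => (Metric.sphere (0 : EuclideanSpace ℝ (Fin (n + 1))) 1)

attribute [local instance] fact_finrank_euclideanSpace_two

namespace LefschetzBase

variable {g : ℕ}

/-! ### Lifts through `ℝ → ℝ/ℤ` on the parameter space `ℝ × ℝ²` -/

section Lifts

/-- **Two continuous real lifts of the same circle map on a preconnected space differ by a
constant.** [cite: HatcherAT2002, Prop. 1.34] -/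
theorem sub_eq_sub_of_lifts {X : Type*} [TopologicalSpace X] [PreconnectedSpace X] {F G : X → ℝ}
    (hF : Continuous F) (hG : Continuous G)
    (h : ∀ x, ((F x : ℝ) : UnitAddCircle) = ((G x : ℝ) : UnitAddCircle)) (x y : X) :
    F x - G x = F y - G y := by
  choose k hk using fun x => exists_int_eq_sub_of_coe_eq (h x)
  have hk' : ∀ x, F x - G x = k x := fun x => by rw [hk x]; ring
  have hkc : Continuous k := by
    rw [Int.isClosedEmbedding_coe_real.isEmbedding.continuous_iff]
    exact (hF.sub hG).congr fun x => hk' x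
  rw [hk' x, hk' y]
  exact_mod_cast PreconnectedSpace.constant inferInstance hkc

variable (f : C(ℝ × 𝔼 2, UnitAddCircle))

/-- A lift of `f (0, 0)` to `ℝ`. [folklore] -/
def basePt : ℝ := Classical.choose (QuotientAddGroup.mk_surjective (f (0, 0)))

/-- The chosen base lift lifts `f (0, 0)`. [folklore] -/
theorem coe_basePt : ((basePt f : ℝ) : UnitAddCircle) = f (0, 0) :=
  Classical.choose_spec (QuotientAddGroup.mk_surjective (f (0, 0)))

/-- **The continuous real lift** of a circle map on `ℝ × ℝ²` (Mathlib's lifting criterion for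
the covering `ℝ → ℝ/ℤ` over a simply connected, locally path-connected space). [cite: HatcherAT2002, Prop. 1.33] -/
def liftR : C(ℝ × 𝔼 2, ℝ) :=
  Classical.choose (isCoveringMap_coe_unitAddCircle.existsUnique_continuousMap_lifts f (0, 0)
    (basePt f) (coe_basePt f)).exists

/-- The lift lifts. [folklore] -/
theorem coe_liftR (z : ℝ × 𝔼 2) : ((liftR f z : ℝ) : UnitAddCircle) = f z :=
  congrFun (Classical.choose_spec (isCoveringMap_coe_unitAddCircle.existsUnique_continuousMap_lifts
    f (0, 0) (basePt f) (coe_basePt f)).exists).2 z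

/-- **The period defect** `d(f) = Λ(1, 0) − Λ(0, 0)` of a circle map on `ℝ × ℝ²`. [cite: BottTu1982Forms, §2 Prop. 2.3] -/
def defect : ℝ := liftR f (1, 0) - liftR f (0, 0)

variable {f}

/-- **For a map of period `1` in `t`, every continuous lift has `Λ(t + 1, v) − Λ(t, v) = d(f)`
everywhere.** [cite: BottTu1982Forms, §2 Prop. 2.3] -/
theorem lift_add_one_sub (hf : ∀ (t : ℝ) (v : 𝔼 2), f (t + 1, v) = f (t, v)) {Λ : ℝ × 𝔼 2 → ℝ}
    (hΛc : Continuous Λ) (hΛ : ∀ z, ((Λ z : ℝ) : UnitAddCircle) = f z) (t : ℝ) (v : 𝔼 2) :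
    Λ (t + 1, v) - Λ (t, v) = defect f := by
  set Λ₀ : ℝ × 𝔼 2 → ℝ := fun z => liftR f z
  have hΛ₀c : Continuous Λ₀ := (liftR f).continuous
  have hΛ₀ : ∀ z, ((Λ₀ z : ℝ) : UnitAddCircle) = f z := coe_liftR f
  have hsh : Continuous fun z : ℝ × 𝔼 2 => ((z.1 + 1, z.2) : ℝ × 𝔼 2) :=
    (continuous_fst.add continuous_const).prodMk continuous_snd
  -- `Λ − Λ₀` is constant
  have h1 := sub_eq_sub_of_lifts hΛc hΛ₀c (fun z => by rw [hΛ, hΛ₀]) (t + 1, v) (t, v)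
  -- `Λ₀ ∘ shift − Λ₀` is constant
  have h2 := sub_eq_sub_of_lifts (hΛ₀c.comp hsh) hΛ₀c
    (fun z => by
      show ((Λ₀ (z.1 + 1, z.2) : ℝ) : UnitAddCircle) = ((Λ₀ z : ℝ) : UnitAddCircle)
      rw [hΛ₀, hΛ₀]; exact hf z.1 z.2) (t, v) (0, 0)
  change Λ₀ (t + 1, v) - Λ₀ (t, v) = Λ₀ (0 + 1, 0) - Λ₀ (0, 0) at h2
  rw [zero_add] at h2
  show Λ (t + 1, v) - Λ (t, v) = Λ₀ (1, 0) - Λ₀ (0, 0)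
  linarith

/-- **Additivity of the defect.** [cite: BottTu1982Forms, §2 Prop. 2.3] -/
theorem defect_add {f f' : C(ℝ × 𝔼 2, UnitAddCircle)} (hf : ∀ (t : ℝ) (v : 𝔼 2), f (t + 1, v) = f (t, v))
    (hf' : ∀ (t : ℝ) (v : 𝔼 2), f' (t + 1, v) = f' (t, v)) :
    defect (f + f') = defect f + defect f' := by
  have hs : ∀ (t : ℝ) (v : 𝔼 2), (f + f') (t + 1, v) = (f + f') (t, v) := fun t v => by
    rw [ContinuousMap.add_apply, ContinuousMap.add_apply, hf, hf']
  have h := lift_add_one_sub hs ((liftR f).continuous.add (liftR f').continuous)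
    (fun z => by
      show (((liftR f z + liftR f' z : ℝ)) : UnitAddCircle) = (f + f') z
      rw [QuotientAddGroup.mk_add, coe_liftR, coe_liftR]; rfl) 0 0
  have h1 := lift_add_one_sub hf (liftR f).continuous (coe_liftR f) 0 0
  have h2 := lift_add_one_sub hf' (liftR f').continuous (coe_liftR f') 0 0
  simp only [Pi.add_apply] at h
  linarith

/-- **Additivity of the defect over finite sums.** [cite: BottTu1982Forms, §2 Prop. 2.3] -/
theorem defect_sum {ι : Type*} (s : Finset ι) (f : ι → C(ℝ × 𝔼 2, UnitAddCircle))
    (hf : ∀ i (t : ℝ) (v : 𝔼 2), f i (t + 1, v) = f i (t, v)) :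
    defect (∑ i ∈ s, f i) = ∑ i ∈ s, defect (f i) := by
  classical
  induction s using Finset.induction_on with
  | empty =>
    rw [Finset.sum_empty, Finset.sum_empty]
    have h := lift_add_one_sub (f := (0 : C(ℝ × 𝔼 2, UnitAddCircle))) (fun _ _ => rfl)
      (Λ := fun _ => (0 : ℝ)) continuous_const (fun _ => rfl) 0 0
    simpa using h.symm
  | insert a s ha ih =>
    have hper : ∀ (t : ℝ) (v : 𝔼 2), (∑ i ∈ s, f i) (t + 1, v) = (∑ i ∈ s, f i) (t, v) := fun t v => by
      simp only [ContinuousMap.coe_sum, Finset.sum_apply, hf]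
    rw [Finset.sum_insert ha, Finset.sum_insert ha, defect_add (hf a) hper, ih]

/-- **Translation invariance of the defect**: if `f'(t, v) = f(t + α, v)` then `d(f') = d(f)`.
[cite: BottTu1982Forms, §2 Prop. 2.3] -/
theorem defect_shift {f f' : C(ℝ × 𝔼 2, UnitAddCircle)} (hf : ∀ (t : ℝ) (v : 𝔼 2), f (t + 1, v) = f (t, v))
    (α : ℝ) (hf' : ∀ (t : ℝ) (v : 𝔼 2), f' (t, v) = f (t + α, v)) : defect f' = defect f := by
  have hs' : ∀ (t : ℝ) (v : 𝔼 2), f' (t + 1, v) = f' (t, v) := fun t v => by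
    rw [hf', hf', add_right_comm, hf]
  have hsh : Continuous fun z : ℝ × 𝔼 2 => ((z.1 + α, z.2) : ℝ × 𝔼 2) :=
    (continuous_fst.add continuous_const).prodMk continuous_snd
  have h := lift_add_one_sub hs' ((liftR f).continuous.comp hsh)
    (fun z => by
      show ((liftR f (z.1 + α, z.2) : ℝ) : UnitAddCircle) = f' z
      rw [coe_liftR]; obtain ⟨t, v⟩ := z; exact (hf' t v).symm) 0 0
  have h' := lift_add_one_sub hf (liftR f).continuous (coe_liftR f) α 0
  change liftR f (0 + 1 + α, (0 : 𝔼 2)) - liftR f (0 + α, 0) = defect f' at h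
  rw [← h, ← h', zero_add, zero_add, add_comm]

/-- **A map with a periodic global real lift has zero defect.** [cite: BottTu1982Forms, §2 Prop. 2.3] -/
theorem defect_eq_zero_of_real_lift {R : ℝ × 𝔼 2 → ℝ} (hRc : Continuous R)
    (hR : ∀ (t : ℝ) (v : 𝔼 2), R (t + 1, v) = R (t, v))
    (hfR : ∀ z, f z = ((R z : ℝ) : UnitAddCircle)) : defect f = 0 := by
  have hf : ∀ (t : ℝ) (v : 𝔼 2), f (t + 1, v) = f (t, v) := fun t v => by rw [hfR, hfR, hR]
  have h := lift_add_one_sub hf hRc (fun z => (hfR z).symm) 0 0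
  rw [← h, hR, sub_self]

/-- **Zero defect means the lift is `1`-periodic**, hence periodic under all integers.
[cite: BottTu1982Forms, §2 Prop. 2.3] -/
theorem liftR_add_int (hf : ∀ (t : ℝ) (v : 𝔼 2), f (t + 1, v) = f (t, v)) (h0 : defect f = 0)
    (t : ℝ) (v : 𝔼 2) (k : ℤ) : liftR f (t + k, v) = liftR f (t, v) := by
  have h1 : ∀ s : ℝ, liftR f (s + 1, v) = liftR f (s, v) := fun s => by
    have := lift_add_one_sub hf (liftR f).continuous (coe_liftR f) s v
    rw [h0] at this; linarith
  have h2 : ∀ s : ℝ, liftR f (s - 1, v) = liftR f (s, v) := fun s => by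
    have := h1 (s - 1); rw [sub_add_cancel] at this; exact this.symm
  induction k using Int.induction_on with
  | zero => simp
  | succ n ih => rw [Int.cast_add, Int.cast_one, ← add_assoc, h1]; exact ih
  | pred n ih => rw [Int.cast_sub, Int.cast_one, ← add_sub_assoc, h2]; exact ih

end Lifts

/-! ### The doubled binding tube as points of the base, and the two symmetries on it -/

/-- The point of the base under the tube parameter `(u, v) ∈ 𝕊¹ × ℝ²`. [folklore] -/
def tubePt (g : ℕ) (q : (𝕊 1) × (𝔼 2)) : Base g := (bBase g).incl (tube g q)

/-- The tube point read in `ℂ²`. [folklore] -/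
@[simp] theorem tubePt_coe (q : (𝕊 1) × (𝔼 2)) : (tubePt g q).1 = tubeAmb g ((q.1 : 𝔼 2), q.2) := rfl

/-- `tubePt` is continuous. [folklore] -/
theorem continuous_tubePt (g : ℕ) : Continuous (tubePt g) :=
  (bBase g).continuous_incl.comp (continuous_tube g)

/-- `toC (circlePt t) = e^{2πit}` as a complex exponential. [folklore] -/
theorem toC_circlePt_eq_exp (t : ℝ) : toC (circlePt t : 𝔼 2) = exp ((2 * π * t : ℝ) * I) := by
  rw [toC_circlePt, Circle.coe_exp]

/-- The rotation number `−ν = −e^{πi/(2g+1)}` realising the sector rotation on the parameter. [folklore] -/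
theorem toC_circlePt_add_rot (g : ℕ) (t : ℝ) :
    toC (circlePt (t + 1 / 2 + 1 / (2 * (2 * g + 1))) : 𝔼 2) =
      -halfRoot (2 * g + 1) * toC (circlePt t : 𝔼 2) := by
  rw [toC_circlePt_eq_exp, toC_circlePt_eq_exp, halfRoot]
  have hn : ((2 * g + 1 : ℕ) : ℂ) ≠ 0 := Nat.cast_ne_zero.2 (odd_ne_zero g)
  have : ((2 * π * (t + 1 / 2 + 1 / (2 * (2 * g + 1))) : ℝ) : ℂ) * I =
      (2 * π * t : ℝ) * I + π * I + π * I / (2 * g + 1 : ℕ) := by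
    push_cast
    field_simp
  rw [this, Complex.exp_add, Complex.exp_add, exp_pi_mul_I]
  ring

/-- `ν² = μ`. [folklore] -/
theorem halfRoot_sq (n : ℕ) : halfRoot n ^ 2 = rootU n := by
  rw [halfRoot, rootU, ← Complex.exp_nat_mul]; push_cast; ring_nf

/-- `(−ν)^{2g+1} = 1` (`ν^{2g+1} = −1`, odd exponent). [folklore] -/
theorem neg_halfRoot_pow (g : ℕ) : (-halfRoot (2 * g + 1)) ^ (2 * g + 1) = 1 := by
  rw [Odd.neg_pow ⟨g, rfl⟩, halfRoot_pow (odd_ne_zero g), neg_neg]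

/-- `conj(−ν)^{2(2g+1)} = 1`. [folklore] -/
theorem conj_neg_halfRoot_pow (g : ℕ) : (starRingEnd ℂ) (-halfRoot (2 * g + 1)) ^ (4 * g + 2) = 1 := by
  have h : (-halfRoot (2 * g + 1)) ^ (4 * g + 2) = 1 := by
    have : 4 * g + 2 = (2 * g + 1) * 2 := by ring
    rw [this, pow_mul, neg_halfRoot_pow, one_pow]
  rw [← map_pow, h, map_one]

/-- `tubeY` is unchanged under `P ↦ −ν P`. [folklore] -/
theorem tubeY_neg_halfRoot_mul (g : ℕ) (P : ℂ) (v : 𝔼 2) :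
    tubeY g (-halfRoot (2 * g + 1) * P) v = tubeY g P v := by
  have hz : zCorr g (-halfRoot (2 * g + 1) * P) v = zCorr g P v := by
    rw [zCorr, zCorr, map_mul, mul_pow, conj_neg_halfRoot_pow, one_mul]
  rw [tubeY, tubeY, hz, mul_pow, neg_halfRoot_pow, one_mul]

/-- **The antipode of the parameter is the sheet involution**: `tubePt (−u, v) = ι (tubePt (u, v))`.
[cite: Milnor1968, §9] -/
theorem tubePt_add_half (t : ℝ) (v : 𝔼 2) :
    tubePt g (circlePt (t + 1 / 2), v) = iota g (tubePt g (circlePt t, v)) := by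
  -- `circlePt (t + 1/2) = −circlePt t` (also `coe_circlePt_add_half` of `CircleMapRegularValues.lean`,
  -- reproved inline to keep the import closure small)
  have hhalf : ((circlePt (t + 1 / 2) : 𝕊 1) : 𝔼 2) = -((circlePt t : 𝕊 1) : 𝔼 2) := by
    apply toC_injective
    rw [toC_neg, toC_circlePt_eq_exp, toC_circlePt_eq_exp]
    have : ((2 * π * (t + 1 / 2) : ℝ) : ℂ) * I = (2 * π * t : ℝ) * I + π * I := by push_cast; ring
    rw [this, Complex.exp_add, exp_pi_mul_I]; ring
  apply Subtype.ext
  rw [tubePt_coe, iota_apply_coe, tubePt_coe, iotaFun]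
  show tubeAmb g (((circlePt (t + 1 / 2) : 𝕊 1) : 𝔼 2), v) = _
  rw [hhalf, tubeAmb_neg]

/-- **The rotated parameter is the sector rotation**: `tubePt (−ν u, v) = R (tubePt (u, v))`.
[cite: Milnor1968, §9] -/
theorem tubePt_add_rot (t : ℝ) (v : 𝔼 2) :
    tubePt g (circlePt (t + 1 / 2 + 1 / (2 * (2 * g + 1))), v) = rot g (tubePt g (circlePt t, v)) := by
  apply Subtype.ext
  rw [tubePt_coe, rot_apply_coe, tubePt_coe, rotFun, cx_tubeAmb, cy_tubeAmb]
  show tubeAmb g (((circlePt (t + 1 / 2 + 1 / (2 * (2 * g + 1))) : 𝕊 1) : 𝔼 2), v) = _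
  rw [tubeAmb]
  dsimp only
  rw [toC_circlePt_add_rot, tubeY_neg_halfRoot_mul, tubeX, mul_pow, neg_sq, halfRoot_sq]
  congr 1
  ring

/-! ### The pulled-back circle maps and their defects -/

/-- **The circle map of a clopen `C ⊆ U ∩ V`, pulled back to the parameter space** of the
doubled binding tube: `f_C(t, v) = φ_C(incl (tube (circlePt t, v)))`. [cite: BottTu1982Forms, §2 Prop. 2.3] -/
def fC (C : Set ↥(coverU g ∩ coverV g)) (hC : IsClopen C) : C(ℝ × 𝔼 2, UnitAddCircle) :=
  ⟨fun z => phiOf C hC (tubePt g (circlePt z.1, z.2)),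
    (phiOf C hC).continuous.comp ((continuous_tubePt g).comp
      ((continuous_circlePt.comp continuous_fst).prodMk continuous_snd))⟩

variable {C C' : Set ↥(coverU g ∩ coverV g)}

/-- Unfolding `fC`. [folklore] -/
theorem fC_apply (hC : IsClopen C) (z : ℝ × 𝔼 2) :
    fC C hC z = phiOf C hC (tubePt g (circlePt z.1, z.2)) := rfl

/-- `f_C` has period `1` in `t`. [folklore] -/
theorem fC_add_one (hC : IsClopen C) (t : ℝ) (v : 𝔼 2) : fC (g := g) C hC (t + 1, v) = fC C hC (t, v) := by
  rw [fC_apply, fC_apply]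
  dsimp only
  rw [circlePt_add_one]

/-- **The defect of a clopen set** `d(C) := d(f_C)`. [cite: BottTu1982Forms, §2 Prop. 2.3] -/
def dC (C : Set ↥(coverU g ∩ coverV g)) (hC : IsClopen C) : ℝ := defect (fC C hC)

/-- `phiOf` does not depend on the clopen-ness witness, and equal sets give equal maps. [folklore] -/
theorem phiOf_congr {hC : IsClopen C} {hC' : IsClopen C'} (h : C = C') (p : Base g) :
    phiOf C hC p = phiOf C' hC' p := by
  subst h; rfl

/-- `fC` of equal sets. [folklore] -/
theorem fC_congr {hC : IsClopen C} {hC' : IsClopen C'} (h : C = C') : fC (g := g) C hC = fC C' hC' := by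
  subst h; rfl

/-- `dC` of equal sets. [folklore] -/
theorem dC_congr {hC : IsClopen C} {hC' : IsClopen C'} (h : C = C') : dC (g := g) C hC = dC C' hC' := by
  subst h; rfl

/-- **Additivity**: `d(C ∪ C') = d(C) + d(C')` for disjoint clopen sets. [cite: BottTu1982Forms, §2 Prop. 2.3] -/
theorem dC_union (hC : IsClopen C) (hC' : IsClopen C') (hd : Disjoint C C') :
    dC (C ∪ C') (hC.union hC') = dC C hC + dC C' hC' := by
  have e : fC (g := g) (C ∪ C') (hC.union hC') = fC C hC + fC C' hC' := by
    ext z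
    rw [ContinuousMap.add_apply, fC_apply, fC_apply, fC_apply, phiOf_union hC hC' hd]
  rw [dC, e, defect_add (fC_add_one hC) (fC_add_one hC'), dC, dC]

/-- **Additivity over finite disjoint unions.** [cite: BottTu1982Forms, §2 Prop. 2.3] -/
theorem dC_iUnion_finset {ι : Type*} (s : Finset ι) (D : ι → Set ↥(coverU g ∩ coverV g))
    (hD : ∀ i, IsClopen (D i)) (hd : Pairwise fun i j => Disjoint (D i) (D j))
    (hU : IsClopen (⋃ i ∈ s, D i)) :
    dC (⋃ i ∈ s, D i) hU = ∑ i ∈ s, dC (D i) (hD i) := by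
  have e : fC (g := g) (⋃ i ∈ s, D i) hU = ∑ i ∈ s, fC (D i) (hD i) := by
    ext z
    rw [fC_apply, phiOf_iUnion_finset s D hD hd hU, ContinuousMap.coe_sum, Finset.sum_apply]
    rfl
  rw [dC, e, defect_sum s _ (fun i => fC_add_one (hD i))]
  rfl

/-- **`d(U ∩ V) = 0`**: the map of `C = U ∩ V` is `ρ_V mod 1`, globally liftable.
[cite: BottTu1982Forms, §2 Ex. 2.5] -/
theorem dC_univ : dC (g := g) univ isClopen_univ = 0 := by
  apply defect_eq_zero_of_real_lift (R := fun z : ℝ × 𝔼 2 => rhoV (tubePt g (circlePt z.1, z.2)))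
  · exact (continuous_rhoV g).comp ((continuous_tubePt g).comp
      ((continuous_circlePt.comp continuous_fst).prodMk continuous_snd))
  · intro t v; dsimp only; rw [circlePt_add_one]
  · intro z; rw [fC_apply, phiOf_univ]

/-- **Invariance under the sheet involution**: `d(ι⁻¹ C) = d(C)`. [cite: Milnor1968, §9] -/
theorem dC_iota (hC : IsClopen C) :
    dC (preimSymm (iota g) rePow_iota C) (isClopen_preimSymm _ _ hC) = dC C hC := by
  apply defect_shift (fC_add_one hC) (1 / 2)
  intro t v
  rw [fC_apply, fC_apply]
  dsimp only
  rw [tubePt_add_half, phiOf_symm (iota g) rePow_iota hC]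

/-- **Invariance under the sector rotation**: `d(R⁻¹ C) = d(C)`. [cite: Milnor1968, §9] -/
theorem dC_rot (hC : IsClopen C) :
    dC (preimSymm (rot g) rePow_rot C) (isClopen_preimSymm _ _ hC) = dC C hC := by
  apply defect_shift (fC_add_one hC) (1 / 2 + 1 / (2 * (2 * g + 1)))
  intro t v
  rw [fC_apply, fC_apply]
  dsimp only
  rw [← add_assoc, tubePt_add_rot, phiOf_symm (rot g) rePow_rot hC]

/-! ### The components of `U ∩ V` all have the same defect, hence defect zero -/

/-- **The component `D_q = idxW⁻¹(q)` of `U ∩ V`**, `q ∈ Fin 2 × Fin (2g+1)`. [cite: Milnor1968, §9 Lemma 9.2] -/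
def Dq (q : Fin 2 × Fin (2 * g + 1)) : Set ↥(coverU g ∩ coverV g) := idxW ⁻¹' {q}

/-- `D_q` is clopen. [folklore] -/
theorem isClopen_Dq (q : Fin 2 × Fin (2 * g + 1)) : IsClopen (Dq (g := g) q) :=
  (isClopen_discrete {q}).preimage idxW.continuous

/-- The `D_q` are pairwise disjoint. [folklore] -/
theorem pairwise_disjoint_Dq : Pairwise fun q q' : Fin 2 × Fin (2 * g + 1) => Disjoint (Dq (g := g) q) (Dq q') :=
  fun _ _ h => Disjoint.preimage _ (disjoint_singleton.2 h)

/-- Membership in `D_q`. [folklore] -/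
@[simp] theorem mem_Dq_iff (q : Fin 2 × Fin (2 * g + 1)) (p : ↥(coverU g ∩ coverV g)) :
    p ∈ Dq q ↔ idxW p = q := Iff.rfl

/-- **`ι⁻¹ D_{(s,k)} = D_{(s+1,k)}`.** [cite: Milnor1968, §9] -/
theorem preimSymm_iota_Dq (s : Fin 2) (k : Fin (2 * g + 1)) :
    preimSymm (iota g) rePow_iota (Dq (s, k)) = Dq (s + 1, k) := by
  ext p
  rw [mem_preimSymm_iff, mem_Dq_iff, mem_Dq_iff]
  refine (Eq.to_iff (congrArg (fun q => q = (s, k)) (idxW_iota p))).trans ?_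
  rw [Prod.ext_iff, Prod.ext_iff]
  dsimp only
  have h11 : (1 : Fin 2) + 1 = 0 := by decide
  constructor
  · rintro ⟨h1, h2⟩
    refine ⟨?_, h2⟩
    rw [← h1, add_assoc, h11, add_zero]
  · rintro ⟨h1, h2⟩
    refine ⟨?_, h2⟩
    rw [h1, add_assoc, h11, add_zero]

/-- **`R⁻¹ D_{(s,k+1)} = D_{(s,k)}`.** [cite: Milnor1968, §9] -/
theorem preimSymm_rot_Dq (s : Fin 2) (k : Fin (2 * g + 1)) :
    preimSymm (rot g) rePow_rot (Dq (s, k + 1)) = Dq (s, k) := by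
  ext p
  rw [mem_preimSymm_iff, mem_Dq_iff, mem_Dq_iff]
  refine (Eq.to_iff (congrArg (fun q => q = (s, k + 1)) (idxW_rot p))).trans ?_
  rw [Prod.ext_iff, Prod.ext_iff]
  dsimp only
  constructor
  · rintro ⟨h1, h2⟩; exact ⟨h1, add_right_cancel h2⟩
  · rintro ⟨h1, h2⟩; exact ⟨h1, by rw [h2]⟩

/-- All components on one sheet have the same defect as the sector-`0` one. [cite: Milnor1968, §9] -/
theorem dC_Dq_eq_zero_sector (s : Fin 2) (k : Fin (2 * g + 1)) :
    dC (Dq (s, k)) (isClopen_Dq _) = dC (g := g) (Dq (s, 0)) (isClopen_Dq _) := by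
  induction k using Fin.induction with
  | zero => rfl
  | succ i ih =>
    rw [← ih, ← dC_rot (isClopen_Dq (s, i.succ))]
    apply dC_congr
    rw [← Fin.coeSucc_eq_succ, preimSymm_rot_Dq]

/-- **All components have the same defect.** [cite: Milnor1968, §9] -/
theorem dC_Dq_eq (q : Fin 2 × Fin (2 * g + 1)) :
    dC (Dq q) (isClopen_Dq _) = dC (g := g) (Dq (0, 0)) (isClopen_Dq _) := by
  obtain ⟨s, k⟩ := q
  rw [dC_Dq_eq_zero_sector s k]
  fin_cases s
  · rfl
  · -- sheet `1`: `D_{(1,0)} = ι⁻¹ D_{(0,0)}`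
    have e : preimSymm (iota g) rePow_iota (Dq (0, 0)) = Dq (g := g) (1, 0) := by
      rw [preimSymm_iota_Dq]; rfl
    rw [← dC_iota (isClopen_Dq (0, 0))]
    exact (dC_congr e).symm

/-- `U ∩ V` is the union of its components. [folklore] -/
theorem iUnion_Dq : (⋃ q ∈ (Finset.univ : Finset (Fin 2 × Fin (2 * g + 1))), Dq (g := g) q) = univ := by
  ext p
  simp only [Finset.mem_univ, iUnion_true, mem_iUnion, mem_Dq_iff, exists_eq', mem_univ]

/-- **Every component has defect zero**: `2(2g+1) · d = Σ_q d(D_q) = d(U ∩ V) = 0`.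
[cite: BottTu1982Forms, §2 Prop. 2.3] -/
theorem dC_Dq (q : Fin 2 × Fin (2 * g + 1)) : dC (Dq q) (isClopen_Dq _) = (0 : ℝ) := by
  have hsum : ∑ q' ∈ (Finset.univ : Finset (Fin 2 × Fin (2 * g + 1))), dC (g := g) (Dq q') (isClopen_Dq _) = 0 := by
    have hU : IsClopen (⋃ q' ∈ (Finset.univ : Finset (Fin 2 × Fin (2 * g + 1))), Dq (g := g) q') := by
      rw [iUnion_Dq]; exact isClopen_univ
    rw [← dC_iUnion_finset Finset.univ Dq isClopen_Dq pairwise_disjoint_Dq hU, dC_congr iUnion_Dq]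
    exact dC_univ
  rw [Finset.sum_congr rfl (fun q' _ => dC_Dq_eq (g := g) q'), Finset.sum_const, Finset.card_univ,
    nsmul_eq_mul] at hsum
  have hcard : (0 : ℝ) < (Fintype.card (Fin 2 × Fin (2 * g + 1)) : ℝ) := by
    rw [Fintype.card_prod, Fintype.card_fin, Fintype.card_fin]; positivity
  rw [dC_Dq_eq]
  exact (mul_eq_zero.1 hsum).resolve_left hcard.ne'

/-- **`C_j` is a union of components**: `C_j = ⋃_{k ≤ j} D_{(0,k)}`. [folklore] -/
theorem Cset_eq_iUnion (j : ℕ) :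
    Cset g j = ⋃ k ∈ (Finset.univ.filter fun k : Fin (2 * g + 1) => (k : ℕ) ≤ j), Dq (0, k) := by
  ext p
  simp only [Cset, mem_setOf_eq, Finset.mem_filter, Finset.mem_univ, true_and, mem_iUnion, mem_Dq_iff,
    exists_prop]
  constructor
  · rintro ⟨h1, h2⟩
    exact ⟨(idxW p).2, h2, Prod.ext h1 rfl⟩
  · rintro ⟨k, hk, h⟩
    rw [h]; exact ⟨rfl, hk⟩

/-- **The defect of `C_j` vanishes.** [cite: BottTu1982Forms, §2 Prop. 2.3] -/
theorem dC_Cset (j : ℕ) : dC (Cset g j) (isClopen_Cset j) = 0 := by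
  have hd : Pairwise fun k k' : Fin (2 * g + 1) => Disjoint (Dq (g := g) (0, k)) (Dq (0, k')) :=
    fun k k' h => pairwise_disjoint_Dq (fun h' => h (Prod.ext_iff.1 h').2)
  have hU : IsClopen (⋃ k ∈ (Finset.univ.filter fun k : Fin (2 * g + 1) => (k : ℕ) ≤ j), Dq (g := g) (0, k)) := by
    rw [← Cset_eq_iUnion]; exact isClopen_Cset j
  rw [dC_congr (Cset_eq_iUnion j) (hC' := hU),
    dC_iUnion_finset _ (fun k => Dq (0, k)) (fun k => isClopen_Dq _) hd hU]
  exact Finset.sum_eq_zero fun k _ => dC_Dq (0, k)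

/-! ### Descent of the periodic lift to the tube -/

/-- Two parameters of the same point of `𝕊¹` differ by an integer. [folklore] -/
theorem exists_int_of_circlePt_eq {θ θ' : ℝ} (h : circlePt θ = circlePt θ') : ∃ k : ℤ, θ = θ' + k := by
  have h1 : Circle.exp (2 * π * θ) = Circle.exp (2 * π * θ') := by
    rw [← toCircle_circlePt, ← toCircle_circlePt, h]
  obtain ⟨m, hm⟩ := Circle.exp_eq_exp.1 h1
  refine ⟨m, ?_⟩
  have hπ : (0 : ℝ) < 2 * π := by positivity
  nlinarith [hm, hπ]

variable (g)

/-- The `1`-periodic lift of `f_{C_j}`. [folklore] -/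
def LamJ (j : ℕ) : C(ℝ × 𝔼 2, ℝ) := liftR (fC (Cset g j) (isClopen_Cset j))

/-- `Λ_j` is periodic under the integers. [folklore] -/
theorem LamJ_add_int (j : ℕ) (t : ℝ) (v : 𝔼 2) (k : ℤ) : LamJ g j (t + k, v) = LamJ g j (t, v) :=
  liftR_add_int (fC_add_one _) (dC_Cset j) t v k

/-- `Λ_j` takes the same value at any two parameters of the same circle point. [folklore] -/
theorem LamJ_eq_of_circlePt_eq (j : ℕ) {θ θ' : ℝ} (h : circlePt θ = circlePt θ') (v : 𝔼 2) :
    LamJ g j (θ, v) = LamJ g j (θ', v) := by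
  obtain ⟨k, rfl⟩ := exists_int_of_circlePt_eq h
  exact LamJ_add_int g j θ' v k

/-- **The lift on the tube**: `L_j(y) = Λ_j(angA u, v)` for `(u, v) = tubeInv y`. [cite: BottTu1982Forms, §2 Prop. 2.3] -/
def liftB (j : ℕ) (y : (bBase g).carrier) : ℝ :=
  LamJ g j (angA (tubeInv g y).1, (tubeInv g y).2)

/-- The same lift through the second angle function. [folklore] -/
theorem liftB_eq_angB (j : ℕ) (y : (bBase g).carrier) :
    liftB g j y = LamJ g j (angB (tubeInv g y).1, (tubeInv g y).2) :=
  LamJ_eq_of_circlePt_eq g j (by rw [circlePt_angA, circlePt_angB]) _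

/-- **`L_j` lifts `phi g j ∘ incl` on the tube.** [cite: BottTu1982Forms, §2 Prop. 2.3] -/
theorem coe_liftB (j : ℕ) {y : (bBase g).carrier} (hy : y ∈ range (tube g)) :
    ((liftB g j y : ℝ) : UnitAddCircle) = phi g j ((bBase g).incl y) := by
  rw [liftB, LamJ, coe_liftR, fC_apply, ← phi_eq_phiOf]
  dsimp only
  rw [circlePt_angA, tubePt]
  have : ((tubeInv g y).1, (tubeInv g y).2) = tubeInv g y := rfl
  rw [this, tube_tubeInv g hy]

/-- `tubeInv` is continuous at the points of the (open) image of the tube. [folklore] -/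
theorem continuousAt_tubeInv {y : (bBase g).carrier} (hy : y ∈ range (tube g)) :
    ContinuousAt (tubeInv g) y :=
  ((contMDiffOn_tubeInv g).continuousOn.continuousWithinAt hy).continuousAt
    ((isOpen_range_tube g).mem_nhds hy)

/-- **`L_j` is continuous at the points of the tube** (near a point use the angle function that
is continuous there; the two formulas agree everywhere by periodicity). [folklore] -/
theorem continuousAt_liftB (j : ℕ) {y : (bBase g).carrier} (hy : y ∈ range (tube g)) :
    ContinuousAt (liftB g j) y := by
  have hT := continuousAt_tubeInv g hy
  by_cases hA : (tubeInv g y).1 = ptA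
  · -- use `angB`, continuous away from `ptB`
    have hB : (tubeInv g y).1 ≠ ptB := by
      rw [hA]; intro h
      have := congrArg (fun u : 𝕊 1 => toC (u : 𝔼 2)) h
      simp only [toC_ptA, toC_ptB] at this
      norm_num at this
    have hc : ContinuousAt (fun y' => LamJ g j (angB (tubeInv g y').1, (tubeInv g y').2)) y :=
      (LamJ g j).continuous.continuousAt.comp
        ((((contMDiffAt_angB hB).continuousAt).comp_of_eq hT.fst rfl).prodMk hT.snd)
    exact hc.congr (Eventually.of_forall fun y' => (liftB_eq_angB g j y').symm)
  · have hc : ContinuousAt (fun y' => LamJ g j (angA (tubeInv g y').1, (tubeInv g y').2)) y :=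
      (LamJ g j).continuous.continuousAt.comp
        ((((contMDiffAt_angA hA).continuousAt).comp_of_eq hT.fst rfl).prodMk hT.snd)
    exact hc

/-- `phi g j ∘ incl` has smooth local real lifts on `∂ Base g`. [folklore] -/
theorem exists_smooth_lift_phi_incl (j : ℕ) (y : (bBase g).carrier) :
    ∃ (W : Set (bBase g).carrier) (F : (bBase g).carrier → ℝ), IsOpen W ∧ y ∈ W ∧
      (∀ q ∈ W, ContMDiffAt (𝓡 3) 𝓘(ℝ, ℝ) ∞ F q) ∧
      ∀ q ∈ W, phi g j ((bBase g).incl q) = ((F q : ℝ) : UnitAddCircle) := by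
  obtain ⟨W, F, hW, hp, hF, hl⟩ := exists_smooth_lift_phi (g := g) j ((bBase g).incl y)
  exact ⟨(bBase g).incl ⁻¹' W, F ∘ (bBase g).incl, hW.preimage (bBase g).continuous_incl, hp,
    fun q hq => (hF _ hq).comp q ((bBase g).isSmoothEmbedding.contMDiff q), fun q hq => hl _ hq⟩

/-- **`L_j` is smooth at the points of the tube**: a continuous lift differs from a smooth local
lift by a local constant. [folklore] -/
theorem contMDiffAt_liftB (j : ℕ) {y : (bBase g).carrier} (hy : y ∈ range (tube g)) :
    ContMDiffAt (𝓡 3) 𝓘(ℝ, ℝ) ∞ (liftB g j) y := by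
  obtain ⟨W, F, hW, hyW, hF, hl⟩ := exists_smooth_lift_phi_incl g j y
  have h1 : ∀ᶠ q in 𝓝 y, phi g j ((bBase g).incl q) = ((liftB g j q : ℝ) : UnitAddCircle) := by
    filter_upwards [(isOpen_range_tube g).mem_nhds hy] with q hq
    exact (coe_liftB g j hq).symm
  have h2 : ∀ᶠ q in 𝓝 y, phi g j ((bBase g).incl q) = ((F q : ℝ) : UnitAddCircle) := by
    filter_upwards [hW.mem_nhds hyW] with q hq
    exact hl q hq
  have hev := Literature.Geometry.Manifold.eventually_sub_eq_const_of_lifts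
    (continuousAt_liftB g j hy) (hF y hyW).continuousAt h1 h2
  have hev' : liftB g j =ᶠ[𝓝 y] fun q => F q + (liftB g j y - F y) := by
    filter_upwards [hev] with q hq
    linarith
  exact ((hF y hyW).add contMDiffAt_const).congr_of_eventuallyEq hev'

/-- **The Mayer–Vietoris circle maps lift near the binding.**  For every `j` there is a real
function `L` on `∂ Base g`, smooth at the points of the binding tube `range (tube g) = {‖w‖ < 1/4}`,
with `phi g j ∘ incl = L mod 1` there. [cite: BottTu1982Forms, §2 Prop. 2.3] [cite: Milnor1968, §9] -/
theorem exists_smooth_lift_phi_incl_tube (g j : ℕ) :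
    ∃ L : (bBase g).carrier → ℝ, (∀ y ∈ range (tube g), ContMDiffAt (𝓡 3) 𝓘(ℝ, ℝ) ∞ L y) ∧
      ∀ y ∈ range (tube g), phi g j ((bBase g).incl y) = ((L y : ℝ) : UnitAddCircle) :=
  ⟨liftB g j, fun _ hy => contMDiffAt_liftB g j hy, fun _ hy => (coe_liftB g j hy).symm⟩

/-- The same on the region `‖w‖ < 1/4` of the boundary (the image of the tube). [folklore] -/
theorem exists_smooth_lift_phi_incl_of_norm_w_lt (g j : ℕ) :
    ∃ L : (bBase g).carrier → ℝ,
      (∀ y, ‖w g (inclB g y)‖ < 1 / 4 → ContMDiffAt (𝓡 3) 𝓘(ℝ, ℝ) ∞ L y) ∧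
      ∀ y, ‖w g (inclB g y)‖ < 1 / 4 → phi g j ((bBase g).incl y) = ((L y : ℝ) : UnitAddCircle) := by
  obtain ⟨L, hL, hl⟩ := exists_smooth_lift_phi_incl_tube g j
  refine ⟨L, fun y hy => hL y ?_, fun y hy => hl y ?_⟩ <;>
  · rw [range_tube]; exact hy

end LefschetzBase

end Literature.Topology.FourManifolds
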